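import Literature.Probability.RandomPlanarGeometry.SchwarzChristoffelTriangle
import Mathlib.Analysis.SpecialFunctions.Complex.LogBounds
import HarnessLib

/-!
# The half-plane kernel `Φ'(w) = i w^{-1/3} (1-w)^{-1/3} g_m(w)` of the oblique harmonic test functions

Layer of the proof of
`Literature.Probability.RandomPlanarGeometry.LawlerSchrammWerner2001_orbm_uniformHitting`
(`ObliqueRBMWedge.lean`): the explicit holomorphic kernel on the upper half-plane whose real
primitive `H = Re Φ` is harmonic, satisfies the oblique boundary conditions of the reflected
Brownian motion on the two rays `(−∞, 0)`, `(1, ∞)` (push directions `e^{iπ/3}`, `e^{2iπ/3}` after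
uniformisation by the Schwarz–Christoffel map of the equilateral triangle), and has an explicit
jump-type trace on `(0, 1)`.

* `cbrtInvDown w = exp(−(log(−iw) + iπ/2)/3)` — the branch of `w^{-1/3}` cut along `−i[0,∞)`; it is
  holomorphic off that ray (in particular across `(−∞,0)`), and agrees with the principal
  `w^{-1/3}` on the upper half-plane (`cbrtInvDown_eq_cpow`); real boundary values
  (`cbrtInvDown_ofReal_pos`, `cbrtInvDown_ofReal_neg`).
* `cbrtInvOneSubDown w = exp(−(log(i(1−w)) − iπ/2)/3)` — the branch of `(1−w)^{-1/3}` cut along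
  `1 − i[0,∞)`, holomorphic across `(1,∞)`, principal on the upper half-plane; boundary values.
* `cauchyKernel m w = ∫₀¹ m(x)/(w − x) dx` for a continuous real density `m` supported in
  `[a, b] ⊂ (0,1)`: holomorphic off `[a,b]` with derivative `−∫ m/(w−x)²` (differentiation under
  the integral sign), the bounds `‖g_m(w)‖ ≤ ‖m‖₁ / dist` and — for MEAN-ZERO `m` — the improved
  decay `‖g_m(w)‖ ≤ 2‖m‖₁/‖w‖²`, `‖g_m'(w)‖ ≤ 8‖m‖₁/‖w‖³` for `‖w‖ ≥ 2`, the symmetry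
  `g_m(w̄) = conj g_m(w)`, and the imaginary part on horizontal lines
  `Im g_m(x + iε) = −∫ m(y) ε/((x−y)² + ε²) dy` (Poisson kernel).
* `testKernel m = i · cbrtInvDown · cbrtInvOneSubDown · cauchyKernel m` — the kernel `Φ'`, its
  holomorphy domain `kernelDomain a b`, and its values on the three real intervals.

## References

* L. V. Ahlfors, *Complex Analysis* (1979), Ch. 6 §2.2 (Schwarz–Christoffel) — the
  constant-phase-on-intervals mechanism; J. Dubédat, Ann. IHP 40 (2004), §4. [Dubedat2004]
-/

noncomputable section

open Set Filter Topology Complex MeasureTheory intervalIntegral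
open scoped Real
open UpperHalfPlane (upperHalfPlaneSet isOpen_upperHalfPlaneSet)

namespace Literature.Probability.RandomPlanarGeometry

/-! ### The branch of `w^{-1/3}` cut downward -/

/-- `w^{-1/3}` with branch cut along the negative imaginary axis `−i[0, ∞)`:
`exp(−(log(−iw) + iπ/2)/3)`. [folklore] -/
def cbrtInvDown (w : ℂ) : ℂ := exp (-((log (-I * w) + I * (π / 2)) / 3))

/-- The holomorphy domain of `cbrtInvDown`: off the ray `{re = 0, im ≤ 0}`. [folklore] -/
theorem neg_I_mul_mem_slitPlane_of_re_ne {w : ℂ} (hw : w.re ≠ 0 ∨ 0 < w.im) : -I * w ∈ slitPlane := by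
  rw [mem_slitPlane_iff]
  have hre : (-I * w).re = w.im := by simp
  have him : (-I * w).im = -w.re := by simp
  rw [hre, him]
  rcases hw with h | h
  · exact Or.inr (by simpa using h)
  · exact Or.inl h

/-- `cbrtInvDown` is complex-differentiable off the downward ray from `0`. [folklore] -/
theorem hasDerivAt_cbrtInvDown {w : ℂ} (hw : w.re ≠ 0 ∨ 0 < w.im) :
    HasDerivAt cbrtInvDown (cbrtInvDown w * (-(1 / (3 * w)))) w := by
  have hw0 : w ≠ 0 := by
    rintro rfl
    simp at hw
  have h1 : HasDerivAt (fun z : ℂ ↦ -I * z) (-I) w := by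
    simpa using (hasDerivAt_id w).const_mul (-I)
  have h2 : HasDerivAt (fun z : ℂ ↦ log (-I * z)) ((-I) / (-I * w)) w :=
    h1.clog (neg_I_mul_mem_slitPlane_of_re_ne hw)
  have h3 : HasDerivAt (fun z : ℂ ↦ -((log (-I * z) + I * (π / 2)) / 3)) (-(((-I) / (-I * w) + 0) / 3)) w :=
    ((h2.add (hasDerivAt_const w _)).div_const 3).neg
  have h4 := h3.cexp
  have hI : (-I : ℂ) ≠ 0 := by simp
  have key : (-I) / (-I * w) = w⁻¹ := by
    rw [div_eq_mul_inv, mul_inv, ← mul_assoc, mul_inv_cancel₀ hI, one_mul]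
  refine h4.congr_deriv ?_
  simp only [cbrtInvDown, key, add_zero]
  have hw3 : (3 : ℂ) * w ≠ 0 := mul_ne_zero (by norm_num) hw0
  congr 1
  field_simp

/-- Auxiliary statement (`differentiableAt_cbrtInvDown`). [folklore] -/
theorem differentiableAt_cbrtInvDown {w : ℂ} (hw : w.re ≠ 0 ∨ 0 < w.im) :
    DifferentiableAt ℂ cbrtInvDown w := (hasDerivAt_cbrtInvDown hw).differentiableAt

/-- Auxiliary statement (`continuousAt_cbrtInvDown`). [folklore] -/
theorem continuousAt_cbrtInvDown {w : ℂ} (hw : w.re ≠ 0 ∨ 0 < w.im) :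
    ContinuousAt cbrtInvDown w := (differentiableAt_cbrtInvDown hw).continuousAt

/-- On the upper half-plane the branch is the principal one: `cbrtInvDown w = w^{-1/3}`. [folklore] -/
theorem cbrtInvDown_eq_cpow {w : ℂ} (hw : 0 < w.im) : cbrtInvDown w = w ^ (-(1 / 3 : ℂ)) := by
  have hw0 : w ≠ 0 := by rintro rfl; simp at hw
  have harg : arg (-I) + arg w ∈ Ioc (-π) π := by
    rw [show arg (-I) = -(π / 2) by simp [arg_neg_I]]
    have h1 : 0 < arg w := arg_pos_of_im_pos hw
    have h2 : arg w ≤ π := arg_le_pi w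
    constructor <;> linarith [Real.pi_pos]
  have hlog : log (-I * w) = log (-I) + log w := (log_mul_eq_add_log_iff (by simp) hw0).2 harg
  rw [cbrtInvDown, hlog, log_neg_I, cpow_def_of_ne_zero hw0]
  congr 1
  ring

/-- Boundary value on `(0, ∞)`: `cbrtInvDown x = x^{-1/3}` (real). [folklore] -/
theorem cbrtInvDown_ofReal_pos {x : ℝ} (hx : 0 < x) : cbrtInvDown x = ((x ^ (-(1 / 3 : ℝ)) : ℝ) : ℂ) := by
  have hx0 : (x : ℂ) ≠ 0 := by exact_mod_cast hx.ne'
  have hlog : log (-I * x) = log (-I) + log x := by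
    refine (log_mul_eq_add_log_iff (by simp) hx0).2 ?_
    rw [show arg (-I) = -(π / 2) by simp [arg_neg_I], arg_ofReal_of_nonneg hx.le]
    constructor <;> linarith [Real.pi_pos]
  rw [cbrtInvDown, hlog, log_neg_I, Complex.ofReal_cpow hx.le, cpow_def_of_ne_zero hx0]
  push_cast
  congr 1
  ring

/-- Boundary value on `(−∞, 0)` (reached from above): `cbrtInvDown x = |x|^{-1/3} e^{-iπ/3}`. [folklore] -/
theorem cbrtInvDown_ofReal_neg {x : ℝ} (hx : x < 0) :
    cbrtInvDown x = (((-x) ^ (-(1 / 3 : ℝ)) : ℝ) : ℂ) * exp (-(π / 3 : ℝ) * I) := by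
  have hx' : 0 < -x := by linarith
  have hx0 : ((-x : ℝ) : ℂ) ≠ 0 := by exact_mod_cast hx'.ne'
  -- `-I x = (-x) I`
  have hprod : -I * (x : ℂ) = I * ((-x : ℝ) : ℂ) := by push_cast; ring
  have hlog : log (I * ((-x : ℝ) : ℂ)) = log I + log ((-x : ℝ) : ℂ) := by
    refine (log_mul_eq_add_log_iff (by simp) hx0).2 ?_
    rw [show arg I = π / 2 by simp [arg_I], arg_ofReal_of_nonneg hx'.le]
    constructor <;> linarith [Real.pi_pos]
  rw [cbrtInvDown, hprod, hlog, log_I, Complex.ofReal_cpow hx'.le, cpow_def_of_ne_zero hx0, ← Complex.exp_add]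
  congr 1
  push_cast
  ring

/-! ### The branch of `(1 - w)^{-1/3}` cut downward from `1` -/

/-- `(1−w)^{-1/3}` with branch cut along `1 − i[0, ∞)`: `exp(−(log(i(1−w)) − iπ/2)/3)`. [folklore] -/
def cbrtInvOneSubDown (w : ℂ) : ℂ := exp (-((log (I * (1 - w)) - I * (π / 2)) / 3))

/-- Auxiliary statement (`I_mul_one_sub_mem_slitPlane`). [folklore] -/
theorem I_mul_one_sub_mem_slitPlane {w : ℂ} (hw : w.re ≠ 1 ∨ 0 < w.im) : I * (1 - w) ∈ slitPlane := by
  rw [mem_slitPlane_iff]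
  have hre : (I * (1 - w)).re = w.im := by simp
  have him : (I * (1 - w)).im = 1 - w.re := by simp
  rw [hre, him]
  rcases hw with h | h
  · exact Or.inr (sub_ne_zero.2 (Ne.symm h))
  · exact Or.inl h

/-- `cbrtInvOneSubDown` is complex-differentiable off the downward ray from `1`. [folklore] -/
theorem hasDerivAt_cbrtInvOneSubDown {w : ℂ} (hw : w.re ≠ 1 ∨ 0 < w.im) :
    HasDerivAt cbrtInvOneSubDown (cbrtInvOneSubDown w * (1 / (3 * (1 - w)))) w := by
  have hw1 : 1 - w ≠ 0 := by
    intro h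
    have : w = 1 := (sub_eq_zero.1 h).symm
    rw [this] at hw; simp at hw
  have h1 : HasDerivAt (fun z : ℂ ↦ I * (1 - z)) (I * (0 - 1)) w :=
    ((hasDerivAt_const w (1:ℂ)).sub (hasDerivAt_id w)).const_mul I
  have h2 : HasDerivAt (fun z : ℂ ↦ log (I * (1 - z))) ((I * (0 - 1)) / (I * (1 - w))) w :=
    h1.clog (I_mul_one_sub_mem_slitPlane hw)
  have h3 : HasDerivAt (fun z : ℂ ↦ -((log (I * (1 - z)) - I * (π / 2)) / 3))
      (-(((I * (0 - 1)) / (I * (1 - w)) - 0) / 3)) w :=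
    ((h2.sub (hasDerivAt_const w _)).div_const 3).neg
  have h4 := h3.cexp
  have hI : (I : ℂ) ≠ 0 := by simp
  have key : (I * (0 - 1)) / (I * (1 - w)) = -(1 - w)⁻¹ := by
    rw [mul_div_mul_left _ _ hI, zero_sub, neg_div, one_div]
  refine h4.congr_deriv ?_
  simp only [cbrtInvOneSubDown, key, sub_zero]
  have hw3 : (3 : ℂ) * (1 - w) ≠ 0 := mul_ne_zero (by norm_num) hw1
  congr 1
  field_simp

/-- Auxiliary statement (`differentiableAt_cbrtInvOneSubDown`). [folklore] -/
theorem differentiableAt_cbrtInvOneSubDown {w : ℂ} (hw : w.re ≠ 1 ∨ 0 < w.im) :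
    DifferentiableAt ℂ cbrtInvOneSubDown w := (hasDerivAt_cbrtInvOneSubDown hw).differentiableAt

/-- Auxiliary statement (`continuousAt_cbrtInvOneSubDown`). [folklore] -/
theorem continuousAt_cbrtInvOneSubDown {w : ℂ} (hw : w.re ≠ 1 ∨ 0 < w.im) :
    ContinuousAt cbrtInvOneSubDown w := (differentiableAt_cbrtInvOneSubDown hw).continuousAt

/-- On the upper half-plane: `cbrtInvOneSubDown w = (1−w)^{-1/3}` (principal). [folklore] -/
theorem cbrtInvOneSubDown_eq_cpow {w : ℂ} (hw : 0 < w.im) :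
    cbrtInvOneSubDown w = (1 - w) ^ (-(1 / 3 : ℂ)) := by
  have hw1 : 1 - w ≠ 0 := by
    intro h; have : w = 1 := (sub_eq_zero.1 h).symm; rw [this] at hw; simp at hw
  have him : (1 - w).im < 0 := by simp; exact hw
  have harg : arg I + arg (1 - w) ∈ Ioc (-π) π := by
    rw [show arg I = π / 2 by simp [arg_I]]
    have h1 : arg (1 - w) < 0 := arg_neg_iff.2 him
    have h2 : -π < arg (1 - w) := neg_pi_lt_arg _
    constructor <;> linarith [Real.pi_pos]
  have hlog : log (I * (1 - w)) = log I + log (1 - w) := (log_mul_eq_add_log_iff (by simp) hw1).2 harg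
  rw [cbrtInvOneSubDown, hlog, log_I, cpow_def_of_ne_zero hw1]
  congr 1
  ring

/-- Boundary value on `(−∞, 1)`: `cbrtInvOneSubDown x = (1−x)^{-1/3}` (real). [folklore] -/
theorem cbrtInvOneSubDown_ofReal_lt_one {x : ℝ} (hx : x < 1) :
    cbrtInvOneSubDown x = (((1 - x) ^ (-(1 / 3 : ℝ)) : ℝ) : ℂ) := by
  have hx' : 0 < 1 - x := by linarith
  have hx0 : ((1 - x : ℝ) : ℂ) ≠ 0 := by exact_mod_cast hx'.ne'
  have hprod : I * (1 - (x : ℂ)) = I * ((1 - x : ℝ) : ℂ) := by push_cast; ring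
  have hlog : log (I * ((1 - x : ℝ) : ℂ)) = log I + log ((1 - x : ℝ) : ℂ) := by
    refine (log_mul_eq_add_log_iff (by simp) hx0).2 ?_
    rw [show arg I = π / 2 by simp [arg_I], arg_ofReal_of_nonneg hx'.le]
    constructor <;> linarith [Real.pi_pos]
  rw [cbrtInvOneSubDown, hprod, hlog, log_I, Complex.ofReal_cpow hx'.le, cpow_def_of_ne_zero hx0]
  push_cast
  congr 1
  ring

/-- Boundary value on `(1, ∞)` (reached from above): `cbrtInvOneSubDown x = |1−x|^{-1/3} e^{iπ/3}`.
[folklore] -/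
theorem cbrtInvOneSubDown_ofReal_one_lt {x : ℝ} (hx : 1 < x) :
    cbrtInvOneSubDown x = (((x - 1) ^ (-(1 / 3 : ℝ)) : ℝ) : ℂ) * exp ((π / 3 : ℝ) * I) := by
  have hx' : 0 < x - 1 := by linarith
  have hx0 : ((x - 1 : ℝ) : ℂ) ≠ 0 := by exact_mod_cast hx'.ne'
  have hprod : I * (1 - (x : ℂ)) = -I * ((x - 1 : ℝ) : ℂ) := by push_cast; ring
  have hlog : log (-I * ((x - 1 : ℝ) : ℂ)) = log (-I) + log ((x - 1 : ℝ) : ℂ) := by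
    refine (log_mul_eq_add_log_iff (by simp) hx0).2 ?_
    rw [show arg (-I) = -(π / 2) by simp [arg_neg_I], arg_ofReal_of_nonneg hx'.le]
    constructor <;> linarith [Real.pi_pos]
  rw [cbrtInvOneSubDown, hprod, hlog, log_neg_I, Complex.ofReal_cpow hx'.le, cpow_def_of_ne_zero hx0,
    ← Complex.exp_add]
  congr 1
  push_cast
  ring

/-! ### Cube identities and norms of the branches -/

/-- `cbrtInvDown w ^ 3 = w⁻¹`. [folklore] -/
theorem cbrtInvDown_pow_three {w : ℂ} (hw : w ≠ 0) : cbrtInvDown w ^ 3 = w⁻¹ := by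
  have hI : (-I : ℂ) ≠ 0 := by simp
  have hIw : -I * w ≠ 0 := mul_ne_zero hI hw
  rw [cbrtInvDown, ← Complex.exp_nat_mul]
  push_cast
  rw [show (3 : ℂ) * -((log (-I * w) + I * (π / 2)) / 3) = -log (-I * w) + -(π / 2 * I) by ring,
    Complex.exp_add, Complex.exp_neg, Complex.exp_log hIw, Complex.exp_neg, exp_pi_div_two_mul_I,
    Complex.inv_I, mul_inv, mul_assoc, mul_comm w⁻¹, ← mul_assoc, inv_mul_cancel₀ hI, one_mul]

/-- `cbrtInvOneSubDown w ^ 3 = (1 - w)⁻¹`. [folklore] -/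
theorem cbrtInvOneSubDown_pow_three {w : ℂ} (hw : w ≠ 1) : cbrtInvOneSubDown w ^ 3 = (1 - w)⁻¹ := by
  have hI : (I : ℂ) ≠ 0 := by simp
  have hw1 : (1 - w) ≠ 0 := sub_ne_zero.2 (Ne.symm hw)
  have hIw : I * (1 - w) ≠ 0 := mul_ne_zero hI hw1
  rw [cbrtInvOneSubDown, ← Complex.exp_nat_mul]
  push_cast
  rw [show (3 : ℂ) * -((log (I * (1 - w)) - I * (π / 2)) / 3) = -log (I * (1 - w)) + π / 2 * I by ring,
    Complex.exp_add, Complex.exp_neg, Complex.exp_log hIw, exp_pi_div_two_mul_I, mul_inv, mul_assoc,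
    mul_comm (1 - w)⁻¹, ← mul_assoc, inv_mul_cancel₀ hI, one_mul]

/-- `‖cbrtInvDown w‖ = ‖w‖^{-1/3}`. [folklore] -/
theorem norm_cbrtInvDown {w : ℂ} (hw : w ≠ 0) : ‖cbrtInvDown w‖ = ‖w‖ ^ (-(1 / 3 : ℝ)) := by
  rw [cbrtInvDown, Complex.norm_exp]
  have hre : (-((log (-I * w) + I * (π / 2)) / 3)).re = -(Real.log ‖w‖) / 3 := by
    simp [Complex.log_re]
    ring
  rw [hre, Real.rpow_def_of_pos (norm_pos_iff.2 hw)]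
  congr 1
  ring

/-- `‖cbrtInvOneSubDown w‖ = ‖1 - w‖^{-1/3}`. [folklore] -/
theorem norm_cbrtInvOneSubDown {w : ℂ} (hw : w ≠ 1) : ‖cbrtInvOneSubDown w‖ = ‖1 - w‖ ^ (-(1 / 3 : ℝ)) := by
  have hw1 : (1 - w) ≠ 0 := sub_ne_zero.2 (Ne.symm hw)
  rw [cbrtInvOneSubDown, Complex.norm_exp]
  have hre : (-((log (I * (1 - w)) - I * (π / 2)) / 3)).re = -(Real.log ‖1 - w‖) / 3 := by
    simp [Complex.log_re]
    ring
  rw [hre, Real.rpow_def_of_pos (norm_pos_iff.2 hw1)]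
  congr 1
  ring

/-! ### The logarithmic Cauchy transform of an interval -/

/-- `L_{a,b}(w) = log((w − a)/(w − b)) = ∫_a^b dx/(w − x)`: the Cauchy transform of the indicator
of `[a, b]`. [folklore] -/
def logRatio (a b : ℝ) (w : ℂ) : ℂ := log ((w - a) / (w - b))

/-- The off-interval domain `{im ≠ 0} ∪ {re < a} ∪ {b < re}` of `L_{a,b}`. [folklore] -/
def offInterval (a b : ℝ) : Set ℂ := {w | w.im ≠ 0 ∨ w.re < a ∨ b < w.re}

/-- Auxiliary statement (`isOpen_offInterval`). [folklore] -/
theorem isOpen_offInterval (a b : ℝ) : IsOpen (offInterval a b) := by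
  unfold offInterval
  refine IsOpen.union (isOpen_ne_fun continuous_im continuous_const) (IsOpen.union ?_ ?_)
  · exact isOpen_lt continuous_re continuous_const
  · exact isOpen_lt continuous_const continuous_re

/-- The imaginary part of the ratio: `Im((w−a)/(w−b)) = (a − b) im w / ‖w − b‖²`. [folklore] -/
theorem ratio_im (a b : ℝ) (w : ℂ) :
    ((w - a) / (w - b)).im = (a - b) * w.im / Complex.normSq (w - (b : ℂ)) := by
  rw [Complex.div_im]
  simp only [sub_re, ofReal_re, sub_im, ofReal_im, sub_zero]
  rw [div_sub_div_same]
  congr 1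
  ring

/-- The real part of the ratio numerator: `Re((w−a) conj(w−b)) = (re w − a)(re w − b) + im w²`.
[folklore] -/
theorem ratio_re (a b : ℝ) (w : ℂ) :
    ((w - a) / (w - b)).re = ((w.re - a) * (w.re - b) + w.im * w.im) / Complex.normSq (w - (b : ℂ)) := by
  rw [Complex.div_re]
  simp only [sub_re, ofReal_re, sub_im, ofReal_im, sub_zero]
  rw [← add_div]

/-- Auxiliary statement (`sub_ofReal_ne_zero_of_mem`). [folklore] -/
theorem sub_ofReal_ne_zero_of_mem {a b : ℝ} (hab : a < b) {w : ℂ} (hw : w ∈ offInterval a b) :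
    w - (b : ℂ) ≠ 0 ∧ w - (a : ℂ) ≠ 0 := by
  constructor
  · intro h
    have h1 : w = b := sub_eq_zero.1 h
    rw [h1] at hw
    rcases hw with h | h | h
    · simp at h
    · simp at h; linarith
    · simp at h
  · intro h
    have h1 : w = a := sub_eq_zero.1 h
    rw [h1] at hw
    rcases hw with h | h | h
    · simp at h
    · simp at h
    · simp at h; linarith

/-- Off `[a, b]` the ratio lies in the slit plane. [folklore] -/
theorem ratio_mem_slitPlane {a b : ℝ} (hab : a < b) {w : ℂ} (hw : w ∈ offInterval a b) :
    (w - a) / (w - b) ∈ slitPlane := by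
  obtain ⟨hb, _⟩ := sub_ofReal_ne_zero_of_mem hab hw
  have hnsq : 0 < Complex.normSq (w - (b : ℂ)) := Complex.normSq_pos.2 hb
  rw [mem_slitPlane_iff, ratio_re, ratio_im]
  rcases hw with h | h | h
  · right
    exact div_ne_zero (mul_ne_zero (by linarith) h) hnsq.ne'
  · left
    refine div_pos ?_ hnsq
    nlinarith [mul_pos (show 0 < a - w.re by linarith) (show 0 < b - w.re by linarith), sq_nonneg w.im]
  · left
    refine div_pos ?_ hnsq
    nlinarith [mul_pos (show 0 < w.re - a by linarith) (show 0 < w.re - b by linarith), sq_nonneg w.im]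

/-- **Holomorphy of `L_{a,b}`** off `[a,b]`, with derivative `1/(w−a) − 1/(w−b)`. [folklore] -/
theorem hasDerivAt_logRatio {a b : ℝ} (hab : a < b) {w : ℂ} (hw : w ∈ offInterval a b) :
    HasDerivAt (logRatio a b) (1 / (w - a) - 1 / (w - b)) w := by
  obtain ⟨hb, ha⟩ := sub_ofReal_ne_zero_of_mem hab hw
  have h1 : HasDerivAt (fun z : ℂ ↦ (z - a) / (z - b)) ((1 * (w - b) - (w - a) * 1) / (w - b) ^ 2) w :=
    ((hasDerivAt_id w).sub_const (a : ℂ)).div ((hasDerivAt_id w).sub_const (b : ℂ)) hb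
  have h2 := h1.clog (ratio_mem_slitPlane hab hw)
  refine h2.congr_deriv ?_
  field_simp

/-- Auxiliary statement (`differentiableOn_logRatio`). [folklore] -/
theorem differentiableOn_logRatio {a b : ℝ} (hab : a < b) :
    DifferentiableOn ℂ (logRatio a b) (offInterval a b) :=
  fun _ hw ↦ (hasDerivAt_logRatio hab hw).differentiableAt.differentiableWithinAt

/-- Auxiliary statement (`continuousAt_logRatio`). [folklore] -/
theorem continuousAt_logRatio {a b : ℝ} (hab : a < b) {w : ℂ} (hw : w ∈ offInterval a b) :
    ContinuousAt (logRatio a b) w := (hasDerivAt_logRatio hab hw).differentiableAt.continuousAt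

/-- Real values off the interval: for real `x ∉ [a, b]`, `L_{a,b}(x) = Real.log((x−a)/(x−b))`.
[folklore] -/
theorem logRatio_ofReal {a b x : ℝ} (hx : x < a ∨ b < x) (hab : a < b) :
    logRatio a b x = ((Real.log ((x - a) / (x - b)) : ℝ) : ℂ) := by
  have hpos : 0 < (x - a) / (x - b) := by
    rcases hx with h | h
    · exact div_pos_of_neg_of_neg (by linarith) (by linarith)
    · exact div_pos (by linarith) (by linarith)
  rw [logRatio, show ((x : ℂ) - a) / (x - b) = (((x - a) / (x - b) : ℝ) : ℂ) by push_cast; ring,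
    Complex.ofReal_log hpos.le]

/-- On the upper half-plane the ratio has negative imaginary part. [folklore] -/
theorem ratio_im_neg {a b : ℝ} (hab : a < b) {w : ℂ} (hw : 0 < w.im) : ((w - a) / (w - b)).im < 0 := by
  have hb : w - (b : ℂ) ≠ 0 := by
    intro h; have : w = b := sub_eq_zero.1 h; rw [this] at hw; simp at hw
  rw [ratio_im]
  exact div_neg_of_neg_of_pos (mul_neg_of_neg_of_pos (by linarith) hw) (Complex.normSq_pos.2 hb)

/-- **Boundary values on the interval from above.** For `x ∈ (a, b)`,
`L_{a,b}(w) → Real.log((x−a)/(b−x)) − iπ` as `w → x` within the upper half-plane. [folklore] -/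
theorem tendsto_logRatio_of_mem_Ioo {a b x : ℝ} (hx : x ∈ Ioo a b) :
    Tendsto (logRatio a b) (𝓝[upperHalfPlaneSet] (x : ℂ))
      (𝓝 (((Real.log ((x - a) / (b - x)) : ℝ) : ℂ) - π * I)) := by
  have hab : a < b := hx.1.trans hx.2
  set r : ℂ := ((x : ℂ) - a) / (x - b) with hr
  have hr' : r = ((((x - a) / (x - b)) : ℝ) : ℂ) := by rw [hr]; push_cast; ring
  have hrre : r.re < 0 := by
    rw [hr', ofReal_re]; exact div_neg_of_pos_of_neg (by linarith [hx.1]) (by linarith [hx.2])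
  have hrim : r.im = 0 := by rw [hr', ofReal_im]
  have hnorm : ‖r‖ = (x - a) / (b - x) := by
    rw [hr', Complex.norm_real, Real.norm_eq_abs, abs_div, abs_of_pos (by linarith [hx.1] : 0 < x - a),
      abs_of_neg (by linarith [hx.2] : x - b < 0), neg_sub]
  have hlog := tendsto_log_nhdsWithin_im_neg_of_re_neg_of_im_zero hrre hrim
  rw [hnorm] at hlog
  -- the ratio map sends `ℍₒ` into `{im < 0}` and is continuous at `x`
  have hxb : (x : ℂ) - b ≠ 0 := by
    rw [show (x : ℂ) - b = ((x - b : ℝ) : ℂ) by push_cast; ring]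
    exact_mod_cast (by linarith [hx.2] : x - b ≠ 0)
  have hcont : ContinuousAt (fun z : ℂ ↦ (z - a) / (z - b)) x :=
    ((continuousAt_id.sub continuousAt_const).div (continuousAt_id.sub continuousAt_const) hxb)
  have hmaps : Tendsto (fun z : ℂ ↦ (z - a) / (z - b)) (𝓝[upperHalfPlaneSet] (x : ℂ))
      (𝓝[{z : ℂ | z.im < 0}] r) := by
    refine tendsto_nhdsWithin_iff.2 ⟨hcont.continuousWithinAt.tendsto, ?_⟩
    filter_upwards [self_mem_nhdsWithin] with z hz
    exact ratio_im_neg hab hz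
  exact hlog.comp hmaps

/-- Norm bound: `‖L_{a,b}(w)‖ ≤ |Real.log(‖w − a‖/‖w − b‖)| + π`. [folklore] -/
theorem norm_logRatio_le {a b : ℝ} (hab : a < b) {w : ℂ} (hw : w ∈ offInterval a b) :
    ‖logRatio a b w‖ ≤ |Real.log (‖w - a‖ / ‖w - b‖)| + π := by
  obtain ⟨hb, ha⟩ := sub_ofReal_ne_zero_of_mem hab hw
  have hq : (w - a) / (w - b) ≠ 0 := div_ne_zero ha hb
  rw [logRatio]
  calc ‖log ((w - a) / (w - b))‖ ≤ |(log ((w - a) / (w - b))).re| + |(log ((w - a) / (w - b))).im| :=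
        Complex.norm_le_abs_re_add_abs_im _
    _ ≤ |Real.log (‖w - a‖ / ‖w - b‖)| + π := by
        refine add_le_add (le_of_eq ?_) ?_
        · rw [Complex.log_re, norm_div]
        · rw [Complex.log_im]; exact abs_arg_le_pi _

/-- **Expansion at infinity**: `‖L_{a,b}(w) − (b − a)/(w − b)‖ ≤ (b − a)²/‖w − b‖²` when
`‖w − b‖ ≥ 2(b − a)`. [folklore] -/
theorem norm_logRatio_sub_le {a b : ℝ} (hab : a < b) {w : ℂ} (hw : w ∈ offInterval a b)
    (hfar : 2 * (b - a) ≤ ‖w - b‖) :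
    ‖logRatio a b w - (b - a) / (w - b)‖ ≤ (b - a) ^ 2 / ‖w - (b : ℂ)‖ ^ 2 := by
  obtain ⟨hb, _⟩ := sub_ofReal_ne_zero_of_mem hab hw
  have hpos : 0 < ‖w - (b : ℂ)‖ := norm_pos_iff.2 hb
  set u : ℂ := (b - a) / (w - b) with hu
  have hratio : (w - a) / (w - b) = 1 + u := by
    rw [hu]; field_simp; ring
  have hnu : ‖u‖ = (b - a) / ‖w - (b : ℂ)‖ := by
    rw [hu, norm_div]
    congr 1
    rw [show ((b : ℂ) - a) = ((b - a : ℝ) : ℂ) by push_cast; ring, Complex.norm_real, Real.norm_eq_abs,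
      abs_of_pos (by linarith)]
  have hu_le : ‖u‖ ≤ 1 / 2 := by
    rw [hnu, div_le_iff₀ hpos]; linarith
  have hu_lt : ‖u‖ < 1 := hu_le.trans_lt (by norm_num)
  rw [logRatio, hratio]
  calc ‖log (1 + u) - u‖ ≤ ‖u‖ ^ 2 * (1 - ‖u‖)⁻¹ / 2 := Complex.norm_log_one_add_sub_self_le hu_lt
    _ ≤ ‖u‖ ^ 2 * 2 / 2 := by
        gcongr
        rw [inv_le_comm₀ (by linarith) (by norm_num)]; linarith
    _ = (b - a) ^ 2 / ‖w - (b : ℂ)‖ ^ 2 := by rw [hnu]; field_simp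

/-! ### The mean-zero two-interval test kernel -/

/-- **Test-kernel data**: two intervals `(α, β)`, `(γ, δ)` inside `(0, 1)`; the test density is
`m = 𝟙_{(α,β)}/(β−α) − 𝟙_{(γ,δ)}/(δ−γ)` (mean zero). [folklore] -/
structure TestIntervals where
  /-- endpoints -/
  α : ℝ
  β : ℝ
  γ : ℝ
  δ : ℝ
  hα : 0 < α
  hαβ : α < β
  hβ : β < 1
  hγ : 0 < γ
  hγδ : γ < δ
  hδ : δ < 1

namespace TestIntervals

variable (D : TestIntervals)

/-- The test density `m = 𝟙_{(α,β)}/(β−α) − 𝟙_{(γ,δ)}/(δ−γ)`. [folklore] -/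
def m (x : ℝ) : ℝ :=
  (Ioo D.α D.β).indicator (fun _ ↦ 1 / (D.β - D.α)) x - (Ioo D.γ D.δ).indicator (fun _ ↦ 1 / (D.δ - D.γ)) x

/-- The Cauchy transform `g(w) = ∫ m(x)/(w − x) dx = L_{α,β}(w)/(β−α) − L_{γ,δ}(w)/(δ−γ)`.
[folklore] -/
def g (w : ℂ) : ℂ := logRatio D.α D.β w / (D.β - D.α) - logRatio D.γ D.δ w / (D.δ - D.γ)

/-- Its derivative `g'(w) = −1/((w−α)(w−β)) + 1/((w−γ)(w−δ))`. [folklore] -/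
def g' (w : ℂ) : ℂ := -(1 / ((w - D.α) * (w - D.β))) + 1 / ((w - D.γ) * (w - D.δ))

/-- The common holomorphy domain of `g`: off `[α,β] ∪ [γ,δ]`. [folklore] -/
def gDomain : Set ℂ := offInterval D.α D.β ∩ offInterval D.γ D.δ

/-- Auxiliary statement (`isOpen_gDomain`). [folklore] -/
theorem isOpen_gDomain : IsOpen D.gDomain := (isOpen_offInterval _ _).inter (isOpen_offInterval _ _)

/-- Auxiliary statement (`mem_gDomain_of_im_ne`). [folklore] -/
theorem mem_gDomain_of_im_ne {w : ℂ} (hw : w.im ≠ 0) : w ∈ D.gDomain := ⟨Or.inl hw, Or.inl hw⟩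

/-- Auxiliary statement (`mem_gDomain_of_im_pos`). [folklore] -/
theorem mem_gDomain_of_im_pos {w : ℂ} (hw : 0 < w.im) : w ∈ D.gDomain := D.mem_gDomain_of_im_ne hw.ne'

/-- Auxiliary statement (`mem_gDomain_of_re_neg`). [folklore] -/
theorem mem_gDomain_of_re_neg {w : ℂ} (hw : w.re < 0) : w ∈ D.gDomain :=
  ⟨Or.inr (Or.inl (hw.trans D.hα)), Or.inr (Or.inl (hw.trans D.hγ))⟩

/-- Auxiliary statement (`mem_gDomain_of_one_lt_re`). [folklore] -/
theorem mem_gDomain_of_one_lt_re {w : ℂ} (hw : 1 < w.re) : w ∈ D.gDomain :=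
  ⟨Or.inr (Or.inr (D.hβ.trans hw)), Or.inr (Or.inr (D.hδ.trans hw))⟩

/-- Auxiliary statement (`mem_gDomain_of_re_le_zero`). [folklore] -/
theorem mem_gDomain_of_re_le_zero {w : ℂ} (hw : w.re ≤ 0) : w ∈ D.gDomain :=
  ⟨Or.inr (Or.inl (hw.trans_lt D.hα)), Or.inr (Or.inl (hw.trans_lt D.hγ))⟩

/-- Auxiliary statement (`mem_gDomain_of_one_le_re`). [folklore] -/
theorem mem_gDomain_of_one_le_re {w : ℂ} (hw : 1 ≤ w.re) : w ∈ D.gDomain :=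
  ⟨Or.inr (Or.inr (D.hβ.trans_le hw)), Or.inr (Or.inr (D.hδ.trans_le hw))⟩

/-- Auxiliary statement (`mem_gDomain_of_two_le_norm`). [folklore] -/
theorem mem_gDomain_of_two_le_norm {w : ℂ} (hw : 2 ≤ ‖w‖) : w ∈ D.gDomain := by
  by_cases him : w.im = 0
  · have : 2 ≤ |w.re| := by
      have h := Complex.norm_le_abs_re_add_abs_im w
      rw [him, abs_zero, add_zero] at h
      exact hw.trans h
    rcases le_abs'.1 this with h | h
    · exact D.mem_gDomain_of_re_le_zero (by linarith)
    · exact D.mem_gDomain_of_one_le_re (by linarith)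
  · exact D.mem_gDomain_of_im_ne him

/-- **Holomorphy of `g`** with derivative `g'`. [folklore] -/
theorem hasDerivAt_g {w : ℂ} (hw : w ∈ D.gDomain) : HasDerivAt D.g (D.g' w) w := by
  have h1 := hasDerivAt_logRatio D.hαβ hw.1
  have h2 := hasDerivAt_logRatio D.hγδ hw.2
  have h := (h1.div_const ((D.β - D.α : ℝ) : ℂ)).sub (h2.div_const ((D.δ - D.γ : ℝ) : ℂ))
  have hba : ((D.β - D.α : ℝ) : ℂ) ≠ 0 := by exact_mod_cast (by linarith [D.hαβ] : D.β - D.α ≠ 0)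
  have hdg : ((D.δ - D.γ : ℝ) : ℂ) ≠ 0 := by exact_mod_cast (by linarith [D.hγδ] : D.δ - D.γ ≠ 0)
  obtain ⟨hb, ha⟩ := sub_ofReal_ne_zero_of_mem D.hαβ hw.1
  obtain ⟨hd, hc⟩ := sub_ofReal_ne_zero_of_mem D.hγδ hw.2
  unfold g g'
  push_cast at h
  refine h.congr_deriv ?_
  push_cast at hba hdg
  field_simp
  ring

/-- Auxiliary statement (`differentiableOn_g`). [folklore] -/
theorem differentiableOn_g : DifferentiableOn ℂ D.g D.gDomain :=
  fun _ hw ↦ (D.hasDerivAt_g hw).differentiableAt.differentiableWithinAt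

/-- Auxiliary statement (`continuousOn_g`). [folklore] -/
theorem continuousOn_g : ContinuousOn D.g D.gDomain := D.differentiableOn_g.continuousOn

/-- `g'` is holomorphic on the domain as well (a rational function). [folklore] -/
theorem differentiableOn_g' : DifferentiableOn ℂ D.g' D.gDomain := by
  intro w hw
  obtain ⟨hb, ha⟩ := sub_ofReal_ne_zero_of_mem D.hαβ hw.1
  obtain ⟨hd, hc⟩ := sub_ofReal_ne_zero_of_mem D.hγδ hw.2
  have h1 : DifferentiableAt ℂ (fun w : ℂ ↦ (w - D.α) * (w - D.β)) w := by fun_prop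
  have h2 : DifferentiableAt ℂ (fun w : ℂ ↦ (w - D.γ) * (w - D.δ)) w := by fun_prop
  have h3 : DifferentiableAt ℂ (fun w : ℂ ↦ -(1 / ((w - D.α) * (w - D.β))) + 1 / ((w - D.γ) * (w - D.δ))) w :=
    (((differentiableAt_const (1:ℂ)).div h1 (mul_ne_zero ha hb)).neg).add
      ((differentiableAt_const (1:ℂ)).div h2 (mul_ne_zero hc hd))
  exact h3.differentiableWithinAt

/-- Auxiliary statement (`continuousOn_g'`). [folklore] -/
theorem continuousOn_g' : ContinuousOn D.g' D.gDomain := D.differentiableOn_g'.continuousOn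

/-- `g` is real on the real axis off the intervals. [folklore] -/
theorem g_ofReal {x : ℝ} (hx : x < D.α ∧ x < D.γ ∨ D.β < x ∧ D.δ < x) :
    D.g x = ((Real.log ((x - D.α) / (x - D.β)) / (D.β - D.α)
      - Real.log ((x - D.γ) / (x - D.δ)) / (D.δ - D.γ) : ℝ) : ℂ) := by
  unfold g
  rcases hx with ⟨h1, h2⟩ | ⟨h1, h2⟩
  · rw [logRatio_ofReal (Or.inl h1) D.hαβ, logRatio_ofReal (Or.inl h2) D.hγδ]; push_cast; ring
  · rw [logRatio_ofReal (Or.inr h1) D.hαβ, logRatio_ofReal (Or.inr h2) D.hγδ]; push_cast; ring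

/-- The real boundary function of `g` (its value / real part of its limit on the real axis).
[folklore] -/
def gRe (x : ℝ) : ℝ :=
  Real.log (|x - D.α| / |x - D.β|) / (D.β - D.α) - Real.log (|x - D.γ| / |x - D.δ|) / (D.δ - D.γ)

/-- Auxiliary statement (`g_ofReal_of_neg`). [folklore] -/
theorem g_ofReal_of_neg {x : ℝ} (hx : x < 0) : D.g x = (D.gRe x : ℂ) := by
  rw [D.g_ofReal (Or.inl ⟨hx.trans D.hα, hx.trans D.hγ⟩), gRe]
  have e1 : (x - D.α) / (x - D.β) = |x - D.α| / |x - D.β| := by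
    rw [abs_of_neg (by linarith [D.hα]), abs_of_neg (by linarith [D.hα, D.hαβ]), neg_div_neg_eq]
  have e2 : (x - D.γ) / (x - D.δ) = |x - D.γ| / |x - D.δ| := by
    rw [abs_of_neg (by linarith [D.hγ]), abs_of_neg (by linarith [D.hγ, D.hγδ]), neg_div_neg_eq]
  rw [e1, e2]

/-- Auxiliary statement (`g_ofReal_of_one_lt`). [folklore] -/
theorem g_ofReal_of_one_lt {x : ℝ} (hx : 1 < x) : D.g x = (D.gRe x : ℂ) := by
  rw [D.g_ofReal (Or.inr ⟨D.hβ.trans hx, D.hδ.trans hx⟩), gRe]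
  rw [abs_of_pos (by linarith [D.hβ, D.hαβ]), abs_of_pos (by linarith [D.hβ]),
    abs_of_pos (by linarith [D.hδ, D.hγδ]), abs_of_pos (by linarith [D.hδ])]

/-- The exceptional (endpoint) set `{α, β, γ, δ}`. [folklore] -/
def endpoints : Set ℝ := {D.α, D.β, D.γ, D.δ}

/-- Auxiliary statement (`endpoints_finite`). [folklore] -/
theorem endpoints_finite : D.endpoints.Finite := by
  unfold endpoints
  exact (((Set.finite_singleton _).insert _).insert _).insert _

/-- Boundary limit of one normalised log-ratio term at a non-endpoint `x`:
real part `Real.log(|x−a|/|x−b|)/(b−a)`, imaginary part `−π 𝟙_{(a,b)}(x)/(b−a)`. [folklore] -/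
theorem tendsto_logRatio_div {a b x : ℝ} (hab : a < b) (hxa : x ≠ a) (hxb : x ≠ b) :
    Tendsto (fun w ↦ logRatio a b w / (b - a)) (𝓝[upperHalfPlaneSet] (x : ℂ))
      (𝓝 (((Real.log (|x - a| / |x - b|) / (b - a) : ℝ) : ℂ)
        - I * ((π * (Ioo a b).indicator (fun _ ↦ 1 / (b - a)) x : ℝ) : ℂ))) := by
  by_cases hx : x ∈ Ioo a b
  · have h := (tendsto_logRatio_of_mem_Ioo hx).div_const ((b : ℂ) - a)
    rw [indicator_of_mem hx]
    convert h using 2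
    rw [abs_of_pos (by linarith [hx.1] : 0 < x - a), abs_of_neg (by linarith [hx.2] : x - b < 0), neg_sub]
    have hba : ((b : ℂ) - a) ≠ 0 := by
      rw [show (b : ℂ) - a = ((b - a : ℝ) : ℂ) by push_cast; ring]
      exact_mod_cast (by linarith : b - a ≠ 0)
    push_cast
    field_simp
  · have hx' : x < a ∨ b < x := by
      simp only [mem_Ioo, not_and_or, not_lt] at hx
      rcases hx with h | h
      · exact Or.inl (lt_of_le_of_ne h hxa)
      · exact Or.inr (lt_of_le_of_ne h (Ne.symm hxb))
    have hmem : (x : ℂ) ∈ offInterval a b := by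
      rcases hx' with h | h
      · exact Or.inr (Or.inl (by simpa using h))
      · exact Or.inr (Or.inr (by simpa using h))
    have hc := ((continuousAt_logRatio hab hmem).tendsto.mono_left
      (nhdsWithin_le_nhds (s := upperHalfPlaneSet))).div_const ((b : ℂ) - a)
    rw [indicator_of_notMem hx, logRatio_ofReal hx' hab] at *
    convert hc using 2
    have e : (x - a) / (x - b) = |x - a| / |x - b| := by
      rcases hx' with h | h
      · rw [abs_of_neg (by linarith), abs_of_neg (by linarith [hab]), neg_div_neg_eq]
      · rw [abs_of_pos (by linarith [hab]), abs_of_pos (by linarith)]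
    rw [e]; push_cast; ring

/-- **Boundary values of `g` on the real axis from above**, away from the four endpoints:
`g(w) → gRe(x) − iπ m(x)`. [folklore] -/
theorem tendsto_g_real {x : ℝ} (hx : x ∉ D.endpoints) :
    Tendsto D.g (𝓝[upperHalfPlaneSet] (x : ℂ)) (𝓝 ((D.gRe x : ℂ) - I * ((π * D.m x : ℝ) : ℂ))) := by
  simp only [endpoints, mem_insert_iff, mem_singleton_iff, not_or] at hx
  obtain ⟨h1, h2, h3, h4⟩ := hx
  have t1 := tendsto_logRatio_div D.hαβ h1 h2
  have t2 := tendsto_logRatio_div D.hγδ h3 h4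
  have := t1.sub t2
  unfold g gRe m
  convert this using 2
  push_cast; ring

/-! ### Decay of the mean-zero kernel at infinity -/

/-- Auxiliary statement (`norm_sub_ofReal_ge`). [folklore] -/
theorem norm_sub_ofReal_ge {w : ℂ} {c : ℝ} (hc : |c| ≤ 1) (hw : 2 ≤ ‖w‖) : ‖w‖ / 2 ≤ ‖w - (c : ℂ)‖ := by
  have h1 : ‖w‖ - ‖(c : ℂ)‖ ≤ ‖w - (c : ℂ)‖ := norm_sub_norm_le w c
  rw [Complex.norm_real, Real.norm_eq_abs] at h1
  linarith

/-- **Decay of `g`**: `‖g(w)‖ ≤ 12/‖w‖²` for `‖w‖ ≥ 4`. [folklore] -/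
theorem norm_g_le {w : ℂ} (hw : 4 ≤ ‖w‖) : ‖D.g w‖ ≤ 12 / ‖w‖ ^ 2 := by
  have hw2 : 2 ≤ ‖w‖ := by linarith
  have hwpos : 0 < ‖w‖ := by linarith
  have hdom := D.mem_gDomain_of_two_le_norm hw2
  have hβ1 : |D.β| ≤ 1 := abs_le.2 ⟨by linarith [D.hα, D.hαβ], D.hβ.le⟩
  have hδ1 : |D.δ| ≤ 1 := abs_le.2 ⟨by linarith [D.hγ, D.hγδ], D.hδ.le⟩
  have hwβ := norm_sub_ofReal_ge hβ1 hw2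
  have hwδ := norm_sub_ofReal_ge hδ1 hw2
  have hwβpos : 0 < ‖w - (D.β : ℂ)‖ := by linarith
  have hwδpos : 0 < ‖w - (D.δ : ℂ)‖ := by linarith
  have hba : 0 < D.β - D.α := by linarith [D.hαβ]
  have hdg : 0 < D.δ - D.γ := by linarith [D.hγδ]
  -- expansions of the two log terms
  have e1 := norm_logRatio_sub_le D.hαβ hdom.1 (by linarith [D.hα, D.hβ])
  have e2 := norm_logRatio_sub_le D.hγδ hdom.2 (by linarith [D.hγ, D.hδ])
  -- main algebraic term
  have hne1 : w - (D.β : ℂ) ≠ 0 := norm_pos_iff.1 hwβpos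
  have hne2 : w - (D.δ : ℂ) ≠ 0 := norm_pos_iff.1 hwδpos
  have hbaC : ((D.β : ℂ) - D.α) ≠ 0 := by
    rw [show (D.β : ℂ) - D.α = ((D.β - D.α : ℝ) : ℂ) by push_cast; ring]; exact_mod_cast hba.ne'
  have hdgC : ((D.δ : ℂ) - D.γ) ≠ 0 := by
    rw [show (D.δ : ℂ) - D.γ = ((D.δ - D.γ : ℝ) : ℂ) by push_cast; ring]; exact_mod_cast hdg.ne'
  have hdecomp : D.g w = (logRatio D.α D.β w - ((D.β : ℂ) - D.α) / (w - D.β)) / ((D.β : ℂ) - D.α)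
      - (logRatio D.γ D.δ w - ((D.δ : ℂ) - D.γ) / (w - D.δ)) / ((D.δ : ℂ) - D.γ)
      + (1 / (w - D.β) - 1 / (w - D.δ)) := by
    unfold g; field_simp; ring
  have hmain : ‖1 / (w - D.β) - 1 / (w - (D.δ : ℂ))‖ ≤ 4 / ‖w‖ ^ 2 := by
    rw [div_sub_div _ _ hne1 hne2, norm_div, norm_mul, one_mul, mul_one]
    have hnum : ‖(w - (D.δ : ℂ)) - (w - D.β)‖ ≤ 1 := by
      rw [show (w - (D.δ : ℂ)) - (w - D.β) = ((D.β - D.δ : ℝ) : ℂ) by push_cast; ring, Complex.norm_real,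
        Real.norm_eq_abs, abs_le]
      constructor <;> linarith [D.hβ, D.hδ, D.hα, D.hαβ, D.hγ, D.hγδ]
    rw [div_le_div_iff₀ (mul_pos hwβpos hwδpos) (by positivity)]
    have : ‖w‖ ^ 2 ≤ 4 * (‖w - (D.β : ℂ)‖ * ‖w - (D.δ : ℂ)‖) := by nlinarith
    nlinarith [norm_nonneg ((w - (D.δ : ℂ)) - (w - D.β))]
  have hn1 : ‖(logRatio D.α D.β w - ((D.β : ℂ) - D.α) / (w - D.β)) / ((D.β : ℂ) - D.α)‖ ≤ 4 / ‖w‖ ^ 2 := by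
    have hnβα : ‖(D.β : ℂ) - D.α‖ = D.β - D.α := by
      rw [show (D.β : ℂ) - D.α = ((D.β - D.α : ℝ) : ℂ) by push_cast; ring, Complex.norm_real,
        Real.norm_eq_abs, abs_of_pos hba]
    rw [norm_div, hnβα, div_le_iff₀ hba]
    refine e1.trans ?_
    rw [div_le_iff₀ (by positivity)]
    have hba1 : D.β - D.α ≤ 1 := by linarith [D.hα, D.hβ]
    have : ‖w‖ ^ 2 ≤ 4 * ‖w - (D.β : ℂ)‖ ^ 2 := by nlinarith
    calc (D.β - D.α) ^ 2 = (D.β - D.α) * (D.β - D.α) := by ring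
      _ ≤ (D.β - D.α) * 1 := by gcongr
      _ ≤ 4 / ‖w‖ ^ 2 * (D.β - D.α) * ‖w - (D.β : ℂ)‖ ^ 2 := by
          rw [mul_one, mul_comm (4 / ‖w‖ ^ 2), mul_assoc]
          apply le_mul_of_one_le_right hba.le
          rw [div_mul_eq_mul_div, le_div_iff₀ (by positivity)]; linarith
  have hn2 : ‖(logRatio D.γ D.δ w - ((D.δ : ℂ) - D.γ) / (w - D.δ)) / ((D.δ : ℂ) - D.γ)‖ ≤ 4 / ‖w‖ ^ 2 := by
    have hnδγ : ‖(D.δ : ℂ) - D.γ‖ = D.δ - D.γ := by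
      rw [show (D.δ : ℂ) - D.γ = ((D.δ - D.γ : ℝ) : ℂ) by push_cast; ring, Complex.norm_real,
        Real.norm_eq_abs, abs_of_pos hdg]
    rw [norm_div, hnδγ, div_le_iff₀ hdg]
    refine e2.trans ?_
    rw [div_le_iff₀ (by positivity)]
    have hdg1 : D.δ - D.γ ≤ 1 := by linarith [D.hγ, D.hδ]
    have : ‖w‖ ^ 2 ≤ 4 * ‖w - (D.δ : ℂ)‖ ^ 2 := by nlinarith
    calc (D.δ - D.γ) ^ 2 = (D.δ - D.γ) * (D.δ - D.γ) := by ring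
      _ ≤ (D.δ - D.γ) * 1 := by gcongr
      _ ≤ 4 / ‖w‖ ^ 2 * (D.δ - D.γ) * ‖w - (D.δ : ℂ)‖ ^ 2 := by
          rw [mul_one, mul_comm (4 / ‖w‖ ^ 2), mul_assoc]
          apply le_mul_of_one_le_right hdg.le
          rw [div_mul_eq_mul_div, le_div_iff₀ (by positivity)]; linarith
  rw [hdecomp]
  calc _ ≤ ‖(logRatio D.α D.β w - ((D.β : ℂ) - D.α) / (w - D.β)) / ((D.β : ℂ) - D.α)
          - (logRatio D.γ D.δ w - ((D.δ : ℂ) - D.γ) / (w - D.δ)) / ((D.δ : ℂ) - D.γ)‖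
          + ‖1 / (w - D.β) - 1 / (w - (D.δ : ℂ))‖ := norm_add_le _ _
    _ ≤ (4 / ‖w‖ ^ 2 + 4 / ‖w‖ ^ 2) + 4 / ‖w‖ ^ 2 := by
        gcongr
        exact (norm_sub_le _ _).trans (add_le_add hn1 hn2)
    _ = 12 / ‖w‖ ^ 2 := by ring

/-- **Decay of `g'`**: `‖g'(w)‖ ≤ 48/‖w‖³` for `‖w‖ ≥ 2`. [folklore] -/
theorem norm_g'_le {w : ℂ} (hw : 2 ≤ ‖w‖) : ‖D.g' w‖ ≤ 48 / ‖w‖ ^ 3 := by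
  have hwpos : 0 < ‖w‖ := by linarith
  have hα1 : |D.α| ≤ 1 := abs_le.2 ⟨by linarith [D.hα], by linarith [D.hαβ, D.hβ]⟩
  have hβ1 : |D.β| ≤ 1 := abs_le.2 ⟨by linarith [D.hα, D.hαβ], D.hβ.le⟩
  have hγ1 : |D.γ| ≤ 1 := abs_le.2 ⟨by linarith [D.hγ], by linarith [D.hγδ, D.hδ]⟩
  have hδ1 : |D.δ| ≤ 1 := abs_le.2 ⟨by linarith [D.hγ, D.hγδ], D.hδ.le⟩
  have ha := norm_sub_ofReal_ge hα1 hw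
  have hb := norm_sub_ofReal_ge hβ1 hw
  have hc := norm_sub_ofReal_ge hγ1 hw
  have hd := norm_sub_ofReal_ge hδ1 hw
  have hapos : 0 < ‖w - (D.α : ℂ)‖ := by linarith
  have hbpos : 0 < ‖w - (D.β : ℂ)‖ := by linarith
  have hcpos : 0 < ‖w - (D.γ : ℂ)‖ := by linarith
  have hdpos : 0 < ‖w - (D.δ : ℂ)‖ := by linarith
  have hne : (w - D.α) * (w - D.β) ≠ 0 := mul_ne_zero (norm_pos_iff.1 hapos) (norm_pos_iff.1 hbpos)
  have hne' : (w - D.γ) * (w - D.δ) ≠ 0 := mul_ne_zero (norm_pos_iff.1 hcpos) (norm_pos_iff.1 hdpos)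
  have hform : D.g' w = (((D.γ + D.δ - D.α - D.β : ℝ) : ℂ) * w + ((D.α * D.β - D.γ * D.δ : ℝ) : ℂ)) /
      ((w - D.α) * (w - D.β) * ((w - D.γ) * (w - D.δ))) := by
    unfold g'
    rw [neg_add_eq_sub, div_sub_div _ _ hne' hne, one_mul, mul_one, mul_comm ((w - D.γ) * (w - D.δ))]
    congr 1; push_cast; ring
  rw [hform, norm_div, norm_mul, norm_mul, norm_mul]
  have hnum : ‖((D.γ + D.δ - D.α - D.β : ℝ) : ℂ) * w + ((D.α * D.β - D.γ * D.δ : ℝ) : ℂ)‖ ≤ 3 * ‖w‖ := by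
    refine (norm_add_le _ _).trans ?_
    rw [norm_mul, Complex.norm_real, Complex.norm_real, Real.norm_eq_abs, Real.norm_eq_abs]
    have h1 : |D.γ + D.δ - D.α - D.β| ≤ 2 := by
      rw [abs_le]; constructor <;> linarith [D.hα, D.hβ, D.hγ, D.hδ, D.hαβ, D.hγδ]
    have h2 : |D.α * D.β - D.γ * D.δ| ≤ 1 := by
      rw [abs_le]; constructor <;>
        nlinarith [D.hα, D.hβ, D.hγ, D.hδ, D.hαβ, D.hγδ, mul_pos D.hα (D.hα.trans D.hαβ),
          mul_pos D.hγ (D.hγ.trans D.hγδ)]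
    nlinarith
  rw [div_le_div_iff₀ (by positivity) (by positivity)]
  have h4 : ‖w‖ ^ 4 ≤ 16 * (‖w - (D.α : ℂ)‖ * ‖w - (D.β : ℂ)‖ * (‖w - (D.γ : ℂ)‖ * ‖w - (D.δ : ℂ)‖)) := by
    have := mul_le_mul (mul_le_mul ha hb (by positivity) (by positivity))
      (mul_le_mul hc hd (by positivity) (by positivity)) (by positivity) (by positivity)
    nlinarith
  calc ‖((D.γ + D.δ - D.α - D.β : ℝ) : ℂ) * w + ((D.α * D.β - D.γ * D.δ : ℝ) : ℂ)‖ * ‖w‖ ^ 3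
      ≤ 3 * ‖w‖ * ‖w‖ ^ 3 := by gcongr
    _ = 3 * ‖w‖ ^ 4 := by ring
    _ ≤ 3 * (16 * (‖w - (D.α : ℂ)‖ * ‖w - (D.β : ℂ)‖ * (‖w - (D.γ : ℂ)‖ * ‖w - (D.δ : ℂ)‖))) := by gcongr
    _ = _ := by ring

/-! ### The kernel `Φ' = i · P · Q · g` -/

/-- The holomorphic kernel `Φ'(w) = i w^{-1/3} (1−w)^{-1/3} g(w)` (downward branches). [folklore] -/
def phiKernel (w : ℂ) : ℂ := I * cbrtInvDown w * cbrtInvOneSubDown w * D.g w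

/-- The holomorphy domain of `Φ'`: off the two downward rays from `0` and `1` and off the two
intervals. It contains the open upper half-plane and the real intervals `(−∞,0)`, `(1,∞)`,
`(0,1) ∖ ([α,β] ∪ [γ,δ])`. [folklore] -/
def kernelDomain : Set ℂ := {w | (w.re ≠ 0 ∨ 0 < w.im) ∧ (w.re ≠ 1 ∨ 0 < w.im)} ∩ D.gDomain

/-- Auxiliary statement (`upperHalfPlaneSet_subset_kernelDomain`). [folklore] -/
theorem upperHalfPlaneSet_subset_kernelDomain : upperHalfPlaneSet ⊆ D.kernelDomain :=
  fun _ hw ↦ ⟨⟨Or.inr hw, Or.inr hw⟩, D.mem_gDomain_of_im_pos hw⟩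

/-- Auxiliary statement (`ofReal_mem_kernelDomain_of_neg`). [folklore] -/
theorem ofReal_mem_kernelDomain_of_neg {x : ℝ} (hx : x < 0) : (x : ℂ) ∈ D.kernelDomain :=
  ⟨⟨Or.inl (by simp; exact hx.ne), Or.inl (by simp; linarith)⟩, D.mem_gDomain_of_re_neg (by simpa using hx)⟩

/-- Auxiliary statement (`ofReal_mem_kernelDomain_of_one_lt`). [folklore] -/
theorem ofReal_mem_kernelDomain_of_one_lt {x : ℝ} (hx : 1 < x) : (x : ℂ) ∈ D.kernelDomain :=
  ⟨⟨Or.inl (by simp; linarith), Or.inl (by simp; exact hx.ne')⟩, D.mem_gDomain_of_one_lt_re (by simpa using hx)⟩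

/-- Auxiliary statement (`isOpen_kernelDomain`). [folklore] -/
theorem isOpen_kernelDomain : IsOpen D.kernelDomain := by
  refine IsOpen.inter (IsOpen.inter ?_ ?_) D.isOpen_gDomain
  · exact (isOpen_ne_fun continuous_re continuous_const).union (isOpen_lt continuous_const continuous_im)
  · exact (isOpen_ne_fun continuous_re continuous_const).union (isOpen_lt continuous_const continuous_im)

/-- **Holomorphy of `Φ'`.** [folklore] -/
theorem differentiableOn_phiKernel : DifferentiableOn ℂ D.phiKernel D.kernelDomain := by
  intro w hw
  apply DifferentiableAt.differentiableWithinAt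
  unfold phiKernel
  exact (((differentiableAt_const I).mul (differentiableAt_cbrtInvDown hw.1.1)).mul
    (differentiableAt_cbrtInvOneSubDown hw.1.2)).mul
    ((D.differentiableOn_g w hw.2).differentiableAt (D.isOpen_gDomain.mem_nhds hw.2))

/-- Auxiliary statement (`continuousOn_phiKernel`). [folklore] -/
theorem continuousOn_phiKernel : ContinuousOn D.phiKernel D.kernelDomain :=
  D.differentiableOn_phiKernel.continuousOn

/-- Auxiliary statement (`differentiableOn_phiKernel_upperHalfPlaneSet`). [folklore] -/
theorem differentiableOn_phiKernel_upperHalfPlaneSet : DifferentiableOn ℂ D.phiKernel upperHalfPlaneSet :=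
  D.differentiableOn_phiKernel.mono D.upperHalfPlaneSet_subset_kernelDomain

/-- **Norm of the kernel**: `‖Φ'(w)‖ = ‖w‖^{-1/3} ‖1−w‖^{-1/3} ‖g(w)‖`. [folklore] -/
theorem norm_phiKernel {w : ℂ} (hw0 : w ≠ 0) (hw1 : w ≠ 1) :
    ‖D.phiKernel w‖ = ‖w‖ ^ (-(1 / 3 : ℝ)) * ‖1 - w‖ ^ (-(1 / 3 : ℝ)) * ‖D.g w‖ := by
  unfold phiKernel
  rw [norm_mul, norm_mul, norm_mul, Complex.norm_I, one_mul, norm_cbrtInvDown hw0, norm_cbrtInvOneSubDown hw1]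

/-- **Decay of the kernel**: `‖Φ'(w)‖ ≤ 12 ‖w‖^{-2}` for `‖w‖ ≥ 4` (crudely, using
`‖w‖^{-1/3}, ‖1-w‖^{-1/3} ≤ 1`). [folklore] -/
theorem norm_phiKernel_le {w : ℂ} (hw : 4 ≤ ‖w‖) : ‖D.phiKernel w‖ ≤ 12 / ‖w‖ ^ 2 := by
  have hw0 : w ≠ 0 := by rintro rfl; norm_num at hw
  have hw1 : w ≠ 1 := by rintro rfl; norm_num at hw
  have h1w : 1 ≤ ‖1 - w‖ := by
    have := norm_sub_norm_le w 1
    rw [norm_one] at this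
    rw [norm_sub_rev]; linarith
  rw [D.norm_phiKernel hw0 hw1]
  have hP : ‖w‖ ^ (-(1 / 3 : ℝ)) ≤ 1 := Real.rpow_le_one_of_one_le_of_nonpos (by linarith) (by norm_num)
  have hQ : ‖1 - w‖ ^ (-(1 / 3 : ℝ)) ≤ 1 := Real.rpow_le_one_of_one_le_of_nonpos h1w (by norm_num)
  calc _ ≤ 1 * 1 * ‖D.g w‖ := by
        apply mul_le_mul _ le_rfl (norm_nonneg _) (by norm_num)
        exact mul_le_mul hP hQ (Real.rpow_nonneg (norm_nonneg _) _) zero_le_one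
    _ = ‖D.g w‖ := by ring
    _ ≤ 12 / ‖w‖ ^ 2 := D.norm_g_le hw

/-- **The kernel on `(−∞, 0)`**: `Φ'(x) = e^{iπ/6} |x|^{-1/3} (1−x)^{-1/3} gRe(x)`. [folklore] -/
theorem phiKernel_ofReal_neg {x : ℝ} (hx : x < 0) :
    D.phiKernel x = exp ((π / 6 : ℝ) * I) *
      (((-x) ^ (-(1 / 3 : ℝ)) * (1 - x) ^ (-(1 / 3 : ℝ)) * D.gRe x : ℝ) : ℂ) := by
  unfold phiKernel
  rw [cbrtInvDown_ofReal_neg hx, cbrtInvOneSubDown_ofReal_lt_one (by linarith), D.g_ofReal_of_neg hx]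
  have key : I * exp (-(π / 3 : ℝ) * I) = exp ((π / 6 : ℝ) * I) := by
    rw [show ((π / 6 : ℝ) : ℂ) * I = π / 2 * I + (-(π / 3 : ℝ) : ℂ) * I by push_cast; ring,
      Complex.exp_add, exp_pi_div_two_mul_I]
  rw [← key]
  simp only [Complex.ofReal_mul]
  ring

/-- **The kernel on `(1, ∞)`**: `Φ'(x) = e^{5iπ/6} x^{-1/3} (x−1)^{-1/3} gRe(x)`. [folklore] -/
theorem phiKernel_ofReal_one_lt {x : ℝ} (hx : 1 < x) :
    D.phiKernel x = exp ((5 * π / 6 : ℝ) * I) *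
      ((x ^ (-(1 / 3 : ℝ)) * (x - 1) ^ (-(1 / 3 : ℝ)) * D.gRe x : ℝ) : ℂ) := by
  unfold phiKernel
  rw [cbrtInvDown_ofReal_pos (by linarith), cbrtInvOneSubDown_ofReal_one_lt hx, D.g_ofReal_of_one_lt hx]
  have key : I * exp ((π / 3 : ℝ) * I) = exp ((5 * π / 6 : ℝ) * I) := by
    rw [show ((5 * π / 6 : ℝ) : ℂ) * I = π / 2 * I + ((π / 3 : ℝ) : ℂ) * I by push_cast; ring,
      Complex.exp_add, exp_pi_div_two_mul_I]
  rw [← key]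
  simp only [Complex.ofReal_mul]
  ring

/-- The real boundary density `ρ̃(x) = x^{-1/3}(1−x)^{-1/3}` on `(0,1)`. [folklore] -/
def rhoTilde (x : ℝ) : ℝ := x ^ (-(1 / 3 : ℝ)) * (1 - x) ^ (-(1 / 3 : ℝ))

/-- Auxiliary statement (`rhoTilde_pos`). [folklore] -/
theorem rhoTilde_pos {x : ℝ} (hx : x ∈ Ioo (0:ℝ) 1) : 0 < rhoTilde x :=
  mul_pos (Real.rpow_pos_of_pos hx.1 _) (Real.rpow_pos_of_pos (by linarith [hx.2]) _)

/-- **Boundary values of the kernel on `(0, 1)` from above** away from the endpoints: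
`Φ'(w) → i ρ̃(x) (gRe x − iπ m(x)) = π ρ̃(x) m(x) + i ρ̃(x) gRe(x)`. [folklore] -/
theorem tendsto_phiKernel_real {x : ℝ} (hx : x ∈ Ioo (0:ℝ) 1) (hxe : x ∉ D.endpoints) :
    Tendsto D.phiKernel (𝓝[upperHalfPlaneSet] (x : ℂ))
      (𝓝 (((π * rhoTilde x * D.m x : ℝ) : ℂ) + I * ((rhoTilde x * D.gRe x : ℝ) : ℂ))) := by
  have hP : ContinuousAt cbrtInvDown (x : ℂ) := continuousAt_cbrtInvDown (Or.inl (by simp; exact hx.1.ne'))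
  have hQ : ContinuousAt cbrtInvOneSubDown (x : ℂ) :=
    continuousAt_cbrtInvOneSubDown (Or.inl (by simp; exact hx.2.ne))
  have hg := D.tendsto_g_real hxe
  have hPQ : Tendsto (fun w ↦ I * cbrtInvDown w * cbrtInvOneSubDown w) (𝓝[upperHalfPlaneSet] (x : ℂ))
      (𝓝 (I * cbrtInvDown x * cbrtInvOneSubDown x)) :=
    ((tendsto_const_nhds.mul (hP.tendsto.mono_left nhdsWithin_le_nhds)).mul
      (hQ.tendsto.mono_left nhdsWithin_le_nhds))
  have := hPQ.mul hg
  unfold phiKernel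
  convert this using 2
  rw [cbrtInvDown_ofReal_pos hx.1, cbrtInvOneSubDown_ofReal_lt_one hx.2, rhoTilde]
  push_cast
  ring_nf
  rw [Complex.I_sq]
  ring

end TestIntervals

end Literature.Probability.RandomPlanarGeometry
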